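import Mathlib.NumberTheory.ArithmeticFunction.VonMangoldt
import Mathlib.NumberTheory.ArithmeticFunction.Moebius
import HarnessLib

/-!
# The parity impostor below level `1/2` — combinatorial core, PROVED

Solo seat `solo-Parity-blind` (summit `Parity`, conjunct `BatemanHorn`), paper §8.2.  For a finite set `P` of
primes (think `P = {p : x^γ < p ≤ x^{γ+η}}`, `γ < 1/2`) and `κ > 0` (think `κ = ∑_{p ∈ P} 1/p`) the IMPOSTOR is

  `a(n) := 1_{Ω(n) even} + κ⁻¹ · #{p ∈ P : p ∣ n} · 1_{Ω(n) odd}`.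

It is nonnegative (`impostor_nonneg`), VANISHES AT EVERY PRIME not in `P` (`impostor_prime`), and its
statistic on any divisor class `d ∣ n` with `d` coprime to the members of `P` is a combination of
EVEN-parity counts in progressions (`class_sum`, from `odd_class_sum`):

  `∑_{n ∈ S, d ∣ n} a(n) = #{n ∈ S : d ∣ n, Ω(n) even} + κ⁻¹ ∑_{p ∈ P} #{n ∈ S : pd ∣ n, Ω(n/p) even}`.

Since `Ω(dk)` has equidistributed parity over `k` in long ranges (prime number theorem for `λ`), each count
on the right is half its range up to `o(·)`, so `a` has perfect Type I statistics — for `a` AND for `λ·a` — at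
every modulus `d ≤ x^γ < min P`, while containing no primes: Type I information of level `γ < 1/2` on both
`a_n` and `λ(n) a_n` cannot produce primes (the analytic step is on paper; this file is the exact finite
skeleton).  Elementary; no `sorry`, standard axioms.
-/

noncomputable section

open Finset
open ArithmeticFunction
open scoped ArithmeticFunction.Omega

namespace Summit.Parity.BatemanHorn.Theorems.SoloBlindParityImpostor

variable {P S : Finset ℕ} {κ : ℝ} {d n p : ℕ}

/-- `g P n` = the number of elements of `P` dividing `n`. -/
def g (P : Finset ℕ) (n : ℕ) : ℕ := (P.filter (· ∣ n)).card

/-- The impostor weight `1_{Ω even} + κ⁻¹ · g · 1_{Ω odd}`. -/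
def impostor (P : Finset ℕ) (κ : ℝ) (n : ℕ) : ℝ :=
  (if Even (Ω n) then 1 else 0) + κ⁻¹ * (g P n : ℝ) * (if Even (Ω n) then 0 else 1)

/-- The impostor is nonnegative. -/
theorem impostor_nonneg (hκ : 0 ≤ κ) : 0 ≤ impostor P κ n := by
  unfold impostor
  have : 0 ≤ κ⁻¹ := inv_nonneg.mpr hκ
  split_ifs <;> positivity

/-- A prime outside `P` (and `1 ∉ P`) has no divisor in `P`. -/
theorem g_eq_zero_of_prime (hp : p.Prime) (hP : ∀ q ∈ P, q ≠ 1 ∧ q ≠ p) : g P p = 0 := by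
  unfold g
  rw [Finset.card_eq_zero, Finset.filter_eq_empty_iff]
  intro q hq hdvd
  rcases (Nat.dvd_prime hp).1 hdvd with h | h
  · exact (hP q hq).1 h
  · exact (hP q hq).2 h

/-- THE IMPOSTOR CONTAINS NO PRIMES (outside `P`): `a(p) = 0`. -/
theorem impostor_prime (hp : p.Prime) (hP : ∀ q ∈ P, q ≠ 1 ∧ q ≠ p) : impostor P κ p = 0 := by
  have hodd : ¬ Even (Ω p) := by
    rw [cardFactors_apply_prime hp]
    exact Nat.not_even_one
  simp [impostor, hodd, g_eq_zero_of_prime hp hP]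

/-- Parity bookkeeping: for a prime `p ∣ n`, `n ≠ 0`, `Ω n` is odd iff `Ω (n / p)` is even. -/
theorem not_even_cardFactors_iff (hp : p.Prime) (hpn : p ∣ n) (hn0 : n ≠ 0) :
    ¬ Even (Ω n) ↔ Even (Ω (n / p)) := by
  have hq0 : n / p ≠ 0 := by
    intro h
    apply hn0
    rw [← Nat.div_mul_cancel hpn, h, zero_mul]
  have hΩ : Ω n = Ω (n / p) + 1 := by
    conv_lhs => rw [← Nat.div_mul_cancel hpn]
    rw [cardFactors_mul hq0 hp.ne_zero, cardFactors_apply_prime hp]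
  rw [hΩ, Nat.even_add_one, not_not]

/-- The key exchange of summations: the ODD-class statistic of `g` at modulus `d` is a sum over `p ∈ P` of
EVEN-parity counts of the cofactor in the progression `pd ∣ n` (for primes `p` coprime to `d`, `0 ∉ S`). -/
theorem odd_class_sum (hS : 0 ∉ S) (hP : ∀ p ∈ P, p.Prime ∧ Nat.Coprime p d) :
    ∑ n ∈ S with (d ∣ n ∧ ¬ Even (Ω n)), (g P n : ℝ)
      = ∑ p ∈ P, (#{n ∈ S | p * d ∣ n ∧ Even (Ω (n / p))} : ℝ) := by
  have hg : ∀ n, (g P n : ℝ) = ∑ p ∈ P, if p ∣ n then (1:ℝ) else 0 := by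
    intro n
    unfold g
    rw [Finset.card_filter]
    push_cast
    rfl
  simp_rw [hg]
  rw [Finset.sum_comm]
  refine Finset.sum_congr rfl fun p hp => ?_
  obtain ⟨hpP, hcop⟩ := hP p hp
  rw [Finset.sum_filter, ← Finset.sum_boole]
  refine Finset.sum_congr rfl fun n hn => ?_
  have hn0 : n ≠ 0 := fun h => hS (h ▸ hn)
  by_cases hpn : p ∣ n
  · have key : (d ∣ n ∧ ¬ Even (Ω n)) ↔ (p * d ∣ n ∧ Even (Ω (n / p))) := by
      have hpar := not_even_cardFactors_iff hpP hpn hn0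
      constructor
      · rintro ⟨hdn, hodd⟩
        exact ⟨hcop.mul_dvd_of_dvd_of_dvd hpn hdn, hpar.mp hodd⟩
      · rintro ⟨hpd, hev⟩
        exact ⟨(dvd_mul_left d p).trans hpd, hpar.mpr hev⟩
    rw [if_pos hpn]
    by_cases hA : (d ∣ n ∧ ¬ Even (Ω n))
    · rw [if_pos hA, if_pos (key.mp hA)]
    · rw [if_neg hA, if_neg (fun hB => hA (key.mpr hB))]
  · have hB : ¬ (p * d ∣ n ∧ Even (Ω (n / p))) := fun h => hpn ((dvd_mul_right p d).trans h.1)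
    rw [if_neg hpn, if_neg hB, ite_self]

/-- EVERY VISIBLE STATISTIC OF THE IMPOSTOR IS A COMBINATION OF EVEN-PARITY COUNTS IN PROGRESSIONS:
`∑_{n ∈ S, d ∣ n} a(n) = #{n ∈ S : d ∣ n, Ω n even} + κ⁻¹ · ∑_{p ∈ P} #{n ∈ S : pd ∣ n, Ω(n/p) even}`. -/
theorem class_sum (hS : 0 ∉ S) (hP : ∀ p ∈ P, p.Prime ∧ Nat.Coprime p d) :
    ∑ n ∈ S with d ∣ n, impostor P κ n
      = (#{n ∈ S | d ∣ n ∧ Even (Ω n)} : ℝ)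
        + κ⁻¹ * ∑ p ∈ P, (#{n ∈ S | p * d ∣ n ∧ Even (Ω (n / p))} : ℝ) := by
  unfold impostor
  rw [Finset.sum_add_distrib]
  congr 1
  · rw [Finset.sum_filter, ← Finset.sum_boole]
    refine Finset.sum_congr rfl fun n _ => ?_
    by_cases h1 : d ∣ n <;> by_cases h2 : Even (Ω n) <;> simp [h1, h2]
  · have h : ∑ n ∈ S with d ∣ n, κ⁻¹ * (g P n : ℝ) * (if Even (Ω n) then 0 else 1)
        = κ⁻¹ * ∑ n ∈ S with (d ∣ n ∧ ¬ Even (Ω n)), (g P n : ℝ) := by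
      rw [Finset.mul_sum, Finset.sum_filter, Finset.sum_filter]
      refine Finset.sum_congr rfl fun n _ => ?_
      by_cases h1 : d ∣ n <;> by_cases h2 : Even (Ω n) <;> simp [h1, h2]
    rw [h, odd_class_sum hS hP]

/-- The `λ`-twisted statistic: `∑_{n ∈ S, d ∣ n} (−1)^{Ω n} a(n) = #{d ∣ n, Ω n even} − κ⁻¹ ∑_p #{pd ∣ n, Ω(n/p) even}`
— the same even-parity counts with the sign of the odd part reversed. -/
theorem class_sum_twisted (hS : 0 ∉ S) (hP : ∀ p ∈ P, p.Prime ∧ Nat.Coprime p d) :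
    ∑ n ∈ S with d ∣ n, (-1 : ℝ) ^ (Ω n) * impostor P κ n
      = (#{n ∈ S | d ∣ n ∧ Even (Ω n)} : ℝ)
        - κ⁻¹ * ∑ p ∈ P, (#{n ∈ S | p * d ∣ n ∧ Even (Ω (n / p))} : ℝ) := by
  have hpt : ∀ n, (-1 : ℝ) ^ (Ω n) * impostor P κ n
      = (if Even (Ω n) then 1 else 0) - κ⁻¹ * (g P n : ℝ) * (if Even (Ω n) then 0 else 1) := by
    intro n
    unfold impostor
    by_cases h2 : Even (Ω n)
    · simp [h2, Even.neg_one_pow h2]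
    · simp [h2, Odd.neg_one_pow (Nat.not_even_iff_odd.mp h2)]
  simp_rw [hpt]
  rw [Finset.sum_sub_distrib]
  congr 1
  · rw [Finset.sum_filter, ← Finset.sum_boole]
    refine Finset.sum_congr rfl fun n _ => ?_
    by_cases h1 : d ∣ n <;> by_cases h2 : Even (Ω n) <;> simp [h1, h2]
  · have h : ∑ n ∈ S with d ∣ n, κ⁻¹ * (g P n : ℝ) * (if Even (Ω n) then 0 else 1)
        = κ⁻¹ * ∑ n ∈ S with (d ∣ n ∧ ¬ Even (Ω n)), (g P n : ℝ) := by
      rw [Finset.mul_sum, Finset.sum_filter, Finset.sum_filter]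
      refine Finset.sum_congr rfl fun n _ => ?_
      by_cases h1 : d ∣ n <;> by_cases h2 : Even (Ω n) <;> simp [h1, h2]
    rw [h, odd_class_sum hS hP]

end Summit.Parity.BatemanHorn.Theorems.SoloBlindParityImpostor

end
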